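import Summits.CriticalPhenomena.PercolationContinuityZ3.Theses.PercExchangeRateTransport
import Summits.CriticalPhenomena.PercolationContinuityZ3.Theorems.PercExchangeRateTransportSubcritExchangeUniformityStubSlopePositiveOnCurve

/-!
# Line `local-exchange-homogeneity` — K⁺ from MARK MIXING: the exchange rate is the orientation-mark
# frequency at pivotals, homogeneous block by block; summed, `(a_n)` is uniformly Cauchy on the closed collar

Crux (fixed, by name): `PercExchangeRateTransport.SupercritExchangeUniformity` (stmt-CriticalPhenomena-16061, K⁺).
Registered by the crux-strategist seat `cstrat-stmt-CriticalPhenomena-16061-b1` (2026-08-17) as an ALTERNATIVE to the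
line `birth`.  Card: `Lines/local_exchange_homogeneity.md`; idea: `Ideas/local-exchange-homogeneity.md`; census:
`STRATEGY-CENSUS.md`; numerics: kit j024461 (shell-homogeneity of V/H to ±2 % on ≥ 90 % of the pivotal mass in the
anisotropic window; face bias confined to lattice depth ≤ 3–4 with n-independent profile; face-layer mass ~ n^{-2.3}).

THE LINE.  By Russo, `a_n = ∂_tΘ_n/∂_pΘ_n = (Σ_V I_n)/(Σ_H I_n)` is the vertical:horizontal frequency of orientation
marks on the necklace of `A_n`-pivotal edges.  Tile `ℤ³` by the blocks `x + Λ_R`, `x ∈ (2R+1)ℤ³`.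
* `stub_derivativeFacts` (M/L, provable now): on the closed `ρ`-collar of every compact sub-arc (which the stub places
  inside the open unit square), the two-parameter RUSSO FORMULA in block-summed form
  (`HasDerivAt (Θ_n(·,t)) (Σ_x SH) p`, `HasDerivAt (Θ_n(p,·)) (Σ_x SV) t` for every block size `R`), Russo
  POSITIVITY `∂_pΘ_n > 0` for `n ≥ 1`, and joint CONTINUITY of `a_n` there (`Θ_n` is a polynomial in `(p,t)`).
* `stub_localHomogeneity` (OPEN, LOAD-BEARING — mark mixing, ℓ¹-block form): ∀η ∃R m: for `n ≥ m` on the collar,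
  `Σ_x |SV − a_R(p,t)·SH| ≤ η·Σ_x SH` — on all but an `η`-fraction of the pivotal MASS, the orientation mix of
  `A_n`-pivotals inside a block equals the small-box exchange rate at the same levels (2D prototype:
  GarbanPeteSchramm2013Pivotal Prop. 11/15, RSW-only coupling; no 3D tool — the honest open core of this line).
* `stub_boxRateAsymptoticLipschitz` (OPEN — "no fan, quantitative"): `|a_R(p,t) − a_R(q,t)| ≤ L|p−q| + ε` for
  `R ≥ R₀(ε)` on the collar (carries K⁺'s Lipschitz clause to the limit; NOT implied by homogeneity).
* `SupercritExchangeUniformity_of : stub₁ₐ → stub₁b → stub₂ → stub₃ → SupercritExchangeUniformity`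
  (REAL proof): Russo + triangle inequality over blocks give `|∂_tΘ_n − a_R ∂_pΘ_n| ≤ η∂_pΘ_n`, positivity turns it
  into `|a_n − a_R| ≤ η`, hence `(a_n)` is uniformly Cauchy on the CLOSED collar (window and curve included); the
  pointwise `limUnder` is then a uniform limit (`CauchySeq.tendsto_limUnder`, `le_of_tendsto`), continuous
  (`TendstoUniformlyOn.continuousOn`) and `L`-Lipschitz (limit of the asymptotic Lipschitz bounds), and the η-clause of
  K⁺ follows by multiplying back by `∂_pΘ_n > 0`.
Honest bookkeeping: stub 2 ∧ stub 3 ∧ (stub 1's positivity) is STRONGER than K⁺ (K⁺ constrains block totals only); no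
stub is K⁺ reworded (stub 1 has no limit, stub 2 no regularity and is spatially resolved, stub 3 no convergence).
Disproof used: none exists for this item (2026-08-17).

RESHAPE by the lead (prover-line-stmt-CriticalPhenomena-16061-0, 2026-08-17): `stub_derivativeFacts` is no longer a stub but a
DERIVED theorem `derivativeFacts_of_stubs` of two smaller registered stubs — `stub_russoBlock` (two-parameter Russo in
block-summed form on the open unit square, all `n R`) and `stub_partialsContinuous` (joint continuity of `∂_tΘ_n`, `∂_pΘ_n` on the
open square) — plus the LANDED sibling theorems `SubcritExchangeUniformity.exists_density_thetaPerc_pos` / `pc_mem_Ioo`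
(collar placement: `0 < p_c(t) ≤ q₀ < 1` uniformly) and `thetaBox_deriv_p_pos` (Russo positivity).  Registered stubs after the
reshape: `stub_russoBlock`, `stub_partialsContinuous`, `stub_localHomogeneity`, `stub_boxRateAsymptoticLipschitz`.
-/

noncomputable section

namespace Summit.CriticalPhenomena.PercolationContinuityZ3.Cruxes.SupercritExchangeUniformity.LocalExchangeHomogeneity

open MeasureTheory Filter Topology
open scoped BigOperators
open Literature.Probability.Percolation Literature.Probability.LatticeModels
open Summit.CriticalPhenomena.PercolationContinuityZ3.Theses.PercExchangeRateTransport (SupercritExchangeUniformity)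

/-! ## Named objects -/

/-- The vertical (`z`-) bonds. -/
def vertBonds : Set (Sym2 (Site 3)) := {e | ∃ x : Site 3, e = s(x, x + Pi.single (2 : Fin 3) 1)}

/-- The label-coupled anisotropic configuration at levels `(p, t)`. -/
def cfgA (p t : ℝ) (U : Sym2 (Site 3) → ℝ) : Set (Sym2 (Site 3)) :=
  {e | e ∈ (zdGraph 3).edgeSet ∧ ((e ∈ vertBonds ∧ U e ≤ t) ∨ (e ∉ vertBonds ∧ U e ≤ p))}

/-- `Θ_n(p,t) = P(0 ↔ ∂Λ_n)`. -/
def boxArm (n : ℕ) (p t : ℝ) : ℝ := (labelMeasure (Site 3)).real {U | cfgA p t U ∈ siteToBoundary 3 n}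

/-- `θ(p,t)`. -/
def thetaA (p t : ℝ) : ℝ := (labelMeasure (Site 3)).real {U | cfgA p t U ∈ percolatesAt (0 : Site 3)}

/-- `p_c(t)`. -/
def pcA (t : ℝ) : ℝ := sInf ({p : ℝ | 0 ≤ p ∧ p ≤ 1 ∧ 0 < thetaA p t} ∪ {1})

/-- `∂_tΘ_n`. -/
def dT (n : ℕ) (p t : ℝ) : ℝ := deriv (fun s => boxArm n p s) t

/-- `∂_pΘ_n`. -/
def dP (n : ℕ) (p t : ℝ) : ℝ := deriv (fun q => boxArm n q t) p

/-- The finite-volume exchange rate `a_n = ∂_tΘ_n/∂_pΘ_n` (also the small-box comparator `a_R`). -/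
def rate (n : ℕ) (p t : ℝ) : ℝ := dT n p t / dP n p t

/-- Pivotal intensity `I_n(e) = P(e pivotal for A_n)` (own label irrelevant: `A_n` is increasing). -/
def piv (n : ℕ) (p t : ℝ) (e : Sym2 (Site 3)) : ℝ :=
  (labelMeasure (Site 3)).real {U | insert e (cfgA p t U) ∈ siteToBoundary 3 n ∧ cfgA p t U \ {e} ∉ siteToBoundary 3 n}

/-- Block sum of vertical intensities over `x + Λ_R`. -/
def SV (n R : ℕ) (x : Site 3) (p t : ℝ) : ℝ := ∑ y ∈ box 3 R, piv n p t s(x + y, x + y + Pi.single (2 : Fin 3) 1)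

/-- Block sum of horizontal intensities over `x + Λ_R`. -/
def SH (n R : ℕ) (x : Site 3) (p t : ℝ) : ℝ :=
  ∑ y ∈ box 3 R, (piv n p t s(x + y, x + y + Pi.single (0 : Fin 3) 1) + piv n p t s(x + y, x + y + Pi.single (1 : Fin 3) 1))

/-- Block centres: `(2R+1)ℤ³ ∩ Λ_{n+2R}` (their `R`-blocks are disjoint and cover `Λ_n`). -/
def centres (n R : ℕ) : Finset (Site 3) := (box 3 (n + 2 * R)).filter (fun x => ∀ i : Fin 3, ((2 * R + 1 : ℕ) : ℤ) ∣ x i)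

/-- The closed supercritical `ρ`-collar of the sub-arc `[lo,hi]`, as a subset of the `(p,t)`-plane. -/
def collar (lo hi ρ : ℝ) : Set (ℝ × ℝ) := {x : ℝ × ℝ | x.2 ∈ Set.Icc lo hi ∧ pcA x.2 ≤ x.1 ∧ x.1 ≤ pcA x.2 + ρ}

/-! ## The three stub `Prop`s (named; the skeleton audit matches hypotheses of `_of` by these names) -/

namespace Stubs

/-- **Stub `Prop` 1a (`russoBlock`).** Two-parameter Russo in block-summed form on the open unit square: for all `n R`
and `(p,t) ∈ (0,1)²`, `∂_pΘ_n = Σ_{x ∈ centres n R} SH` and `∂_tΘ_n = Σ_x SV` as `HasDerivAt` statements. -/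
def stub_russoBlock : Prop :=
  let μ := Literature.Probability.Percolation.labelMeasure (Literature.Probability.LatticeModels.Site 3); let vert : Sym2 (Literature.Probability.LatticeModels.Site 3) → Prop := fun e => ∃ x : Literature.Probability.LatticeModels.Site 3, e = s(x, x + Pi.single (2 : Fin 3) 1); let cfg : ℝ → ℝ → (Sym2 (Literature.Probability.LatticeModels.Site 3) → ℝ) → Set (Sym2 (Literature.Probability.LatticeModels.Site 3)) := fun p t U => {e | e ∈ (Literature.Probability.LatticeModels.zdGraph 3).edgeSet ∧ ((vert e ∧ U e ≤ t) ∨ (¬ vert e ∧ U e ≤ p))}; let Θ : ℕ → ℝ → ℝ → ℝ := fun n p t => μ.real {U | cfg p t U ∈ Literature.Probability.Percolation.siteToBoundary 3 n}; let I : ℕ → ℝ → ℝ → Sym2 (Literature.Probability.LatticeModels.Site 3) → ℝ := fun n p t e => μ.real {U | insert e (cfg p t U) ∈ Literature.Probability.Percolation.siteToBoundary 3 n ∧ (cfg p t U) \ {e} ∉ Literature.Probability.Percolation.siteToBoundary 3 n}; let SV : ℕ → ℕ → Literature.Probability.LatticeModels.Site 3 → ℝ → ℝ → ℝ := fun n R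 x p t => ∑ y ∈ Literature.Probability.LatticeModels.box 3 R, I n p t s(x + y, x + y + Pi.single (2 : Fin 3) 1); let SH : ℕ → ℕ → Literature.Probability.LatticeModels.Site 3 → ℝ → ℝ → ℝ := fun n R x p t => ∑ y ∈ Literature.Probability.LatticeModels.box 3 R, (I n p t s(x + y, x + y + Pi.single (0 : Fin 3) 1) + I n p t s(x + y, x + y + Pi.single (1 : Fin 3) 1)); let centres : ℕ → ℕ → Finset (Literature.Probability.LatticeModels.Site 3) := fun n R => (Literature.Probability.LatticeModels.box 3 (n + 2 * R)).filter (fun x => ∀ i : Fin 3, ((2 * R + 1 : ℕ) : ℤ) ∣ x i); ∀ R n : ℕ, ∀ p ∈ Set.Ioo (0 : ℝ) 1, ∀ t ∈ Set.Ioo (0 : ℝ) 1, HasDerivAt (fun q => Θ n q t) (∑ x ∈ centres n R, SH n R x p t) p ∧ HasDerivAt (fun s => Θ n p s) (∑ x ∈ centres n R, SV n R x p t) t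

/-- **Stub `Prop` 1b (`partialsContinuous`).** Joint continuity of the two partial derivatives of `Θ_n` on the open unit
square (`Θ_n` is a polynomial there). -/
def stub_partialsContinuous : Prop :=
  let μ := Literature.Probability.Percolation.labelMeasure (Literature.Probability.LatticeModels.Site 3); let vert : Sym2 (Literature.Probability.LatticeModels.Site 3) → Prop := fun e => ∃ x : Literature.Probability.LatticeModels.Site 3, e = s(x, x + Pi.single (2 : Fin 3) 1); let cfg : ℝ → ℝ → (Sym2 (Literature.Probability.LatticeModels.Site 3) → ℝ) → Set (Sym2 (Literature.Probability.LatticeModels.Site 3)) := fun p t U => {e | e ∈ (Literature.Probability.LatticeModels.zdGraph 3).edgeSet ∧ ((vert e ∧ U e ≤ t) ∨ (¬ vert e ∧ U e ≤ p))}; let Θ : ℕ → ℝ → ℝ → ℝ := fun n p t => μ.real {U | cfg p t U ∈ Literature.Probability.Percolation.siteToBoundary 3 n}; ∀ n : ℕ, ContinuousOn (fun x : ℝ × ℝ => deriv (fun s => Θ n x.1 s) x.2) (Set.Ioo (0 : ℝ) 1 ×ˢ Set.Ioo (0 : ℝ) 1) ∧ ContinuousOn (fun x : ℝ × ℝ =>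 deriv (fun q => Θ n q x.2) x.1) (Set.Ioo (0 : ℝ) 1 ×ˢ Set.Ioo (0 : ℝ) 1)

/-- **Derived `Prop` 1 (`derivativeFacts`, NO LONGER A STUB).** Two-parameter Russo in block-summed form, Russo positivity and joint
continuity of the exchange rate on a closed supercritical collar (placed inside the open unit square). -/
def stub_derivativeFacts : Prop :=
  let μ := Literature.Probability.Percolation.labelMeasure (Literature.Probability.LatticeModels.Site 3); let vert : Sym2 (Literature.Probability.LatticeModels.Site 3) → Prop := fun e => ∃ x : Literature.Probability.LatticeModels.Site 3, e = s(x, x + Pi.single (2 : Fin 3) 1); let cfg : ℝ → ℝ → (Sym2 (Literature.Probability.LatticeModels.Site 3) → ℝ) → Set (Sym2 (Literature.Probability.LatticeModels.Site 3)) := fun p t U => {e | e ∈ (Literature.Probability.LatticeModels.zdGraph 3).edgeSet ∧ ((vert e ∧ U e ≤ t) ∨ (¬ vert e ∧ U e ≤ p))}; let Θ : ℕ → ℝ → ℝ → ℝ := fun n p t => μ.real {U | cfg p t U ∈ Literature.Probability.Percolation.siteToBoundary 3 n}; let θ : ℝ → ℝ → ℝ := fun p t => μ.real {U | cfg p t U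 ∈ Literature.Probability.Percolation.percolatesAt (0 : Literature.Probability.LatticeModels.Site 3)}; let pc : ℝ → ℝ := fun t => sInf ({p : ℝ | 0 ≤ p ∧ p ≤ 1 ∧ 0 < θ p t} ∪ {1}); let I : ℕ → ℝ → ℝ → Sym2 (Literature.Probability.LatticeModels.Site 3) → ℝ := fun n p t e => μ.real {U | insert e (cfg p t U) ∈ Literature.Probability.Percolation.siteToBoundary 3 n ∧ (cfg p t U) \ {e} ∉ Literature.Probability.Percolation.siteToBoundary 3 n}; let SV : ℕ → ℕ → Literature.Probability.LatticeModels.Site 3 → ℝ → ℝ → ℝ := fun n R x p t => ∑ y ∈ Literature.Probability.LatticeModels.box 3 R, I n p t s(x + y, x + y + Pi.single (2 : Fin 3) 1); let SH : ℕ → ℕ → Literature.Probability.LatticeModels.Site 3 → ℝ → ℝ → ℝ := fun n R x p t => ∑ y ∈ Literature.Probability.LatticeModels.box 3 R, (I n p t s(x + y, x + y + Pi.single (0 : Fin 3) 1) + I n p t s(x + y, x + y + Pi.single (1 : Fin 3) 1)); let centres : ℕ → ℕ → Finset (Literature.Probability.LatticeModels.Site 3) := fun n R => (Literature.Probability.LatticeModels.box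 3 (n + 2 * R)).filter (fun x => ∀ i : Fin 3, ((2 * R + 1 : ℕ) : ℤ) ∣ x i); ∀ lo hi : ℝ, 0 < lo → lo < hi → hi < 1 → ∃ ρ > (0 : ℝ), (∀ R n : ℕ, ∀ t ∈ Set.Icc lo hi, ∀ p : ℝ, pc t ≤ p → p ≤ pc t + ρ → HasDerivAt (fun q => Θ n q t) (∑ x ∈ centres n R, SH n R x p t) p ∧ HasDerivAt (fun s => Θ n p s) (∑ x ∈ centres n R, SV n R x p t) t) ∧ (∀ n : ℕ, 1 ≤ n → ∀ t ∈ Set.Icc lo hi, ∀ p : ℝ, pc t ≤ p → p ≤ pc t + ρ → 0 < deriv (fun q => Θ n q t) p) ∧ (∀ n : ℕ, 1 ≤ n → ContinuousOn (fun x : ℝ × ℝ => deriv (fun s => Θ n x.1 s) x.2 / deriv (fun q => Θ n q x.2) x.1) {x : ℝ × ℝ | x.2 ∈ Set.Icc lo hi ∧ pc x.2 ≤ x.1 ∧ x.1 ≤ pc x.2 + ρ})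

/-- **Stub `Prop` 2 (`localHomogeneity`, LOAD-BEARING).** ℓ¹-block mark mixing: block by block the vertical
pivotal intensity equals the small-box exchange rate times the horizontal one, up to an `η`-fraction of the mass. -/
def stub_localHomogeneity : Prop :=
  let μ := Literature.Probability.Percolation.labelMeasure (Literature.Probability.LatticeModels.Site 3); let vert : Sym2 (Literature.Probability.LatticeModels.Site 3) → Prop := fun e => ∃ x : Literature.Probability.LatticeModels.Site 3, e = s(x, x + Pi.single (2 : Fin 3) 1); let cfg : ℝ → ℝ → (Sym2 (Literature.Probability.LatticeModels.Site 3) → ℝ) → Set (Sym2 (Literature.Probability.LatticeModels.Site 3)) := fun p t U => {e | e ∈ (Literature.Probability.LatticeModels.zdGraph 3).edgeSet ∧ ((vert e ∧ U e ≤ t) ∨ (¬ vert e ∧ U e ≤ p))}; let Θ : ℕ → ℝ → ℝ → ℝ := fun n p t => μ.real {U | cfg p t U ∈ Literature.Probability.Percolation.siteToBoundary 3 n}; let θ : ℝ → ℝ → ℝ := fun p t => μ.real {U | cfg p t U ∈ Literature.Probability.Percolation.percolatesAt (0 : Literature.Probability.LatticeModels.Site 3)}; let pc : ℝ → ℝ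 := fun t => sInf ({p : ℝ | 0 ≤ p ∧ p ≤ 1 ∧ 0 < θ p t} ∪ {1}); let I : ℕ → ℝ → ℝ → Sym2 (Literature.Probability.LatticeModels.Site 3) → ℝ := fun n p t e => μ.real {U | insert e (cfg p t U) ∈ Literature.Probability.Percolation.siteToBoundary 3 n ∧ (cfg p t U) \ {e} ∉ Literature.Probability.Percolation.siteToBoundary 3 n}; let SV : ℕ → ℕ → Literature.Probability.LatticeModels.Site 3 → ℝ → ℝ → ℝ := fun n R x p t => ∑ y ∈ Literature.Probability.LatticeModels.box 3 R, I n p t s(x + y, x + y + Pi.single (2 : Fin 3) 1); let SH : ℕ → ℕ → Literature.Probability.LatticeModels.Site 3 → ℝ → ℝ → ℝ := fun n R x p t => ∑ y ∈ Literature.Probability.LatticeModels.box 3 R, (I n p t s(x + y, x + y + Pi.single (0 : Fin 3) 1) + I n p t s(x + y, x + y + Pi.single (1 : Fin 3) 1)); let centres : ℕ → ℕ → Finset (Literature.Probability.LatticeModels.Site 3) := fun n R => (Literature.Probability.LatticeModels.box 3 (n + 2 * R)).filter (fun x => ∀ i : Fin 3, ((2 * R + 1 : ℕ) : ℤ) ∣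 x i); ∀ lo hi : ℝ, 0 < lo → lo < hi → hi < 1 → ∃ ρ > (0 : ℝ), ∀ η > (0 : ℝ), ∃ R : ℕ, ∃ m : ℕ, ∀ n ≥ m, ∀ t ∈ Set.Icc lo hi, ∀ p : ℝ, pc t ≤ p → p ≤ pc t + ρ → ∑ x ∈ centres n R, |SV n R x p t - (deriv (fun s => Θ R p s) t / deriv (fun q => Θ R q t) p) * SH n R x p t| ≤ η * ∑ x ∈ centres n R, SH n R x p t

/-- **Stub `Prop` 3 (`boxRateAsymptoticLipschitz`).** Asymptotic `p`-Lipschitz regularity of the box rates. -/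
def stub_boxRateAsymptoticLipschitz : Prop :=
  let μ := Literature.Probability.Percolation.labelMeasure (Literature.Probability.LatticeModels.Site 3); let vert : Sym2 (Literature.Probability.LatticeModels.Site 3) → Prop := fun e => ∃ x : Literature.Probability.LatticeModels.Site 3, e = s(x, x + Pi.single (2 : Fin 3) 1); let cfg : ℝ → ℝ → (Sym2 (Literature.Probability.LatticeModels.Site 3) → ℝ) → Set (Sym2 (Literature.Probability.LatticeModels.Site 3)) := fun p t U => {e | e ∈ (Literature.Probability.LatticeModels.zdGraph 3).edgeSet ∧ ((vert e ∧ U e ≤ t) ∨ (¬ vert e ∧ U e ≤ p))}; let Θ : ℕ → ℝ → ℝ → ℝ := fun n p t => μ.real {U | cfg p t U ∈ Literature.Probability.Percolation.siteToBoundary 3 n}; let θ : ℝ → ℝ → ℝ := fun p t => μ.real {U | cfg p t U ∈ Literature.Probability.Percolation.percolatesAt (0 : Literature.Probability.LatticeModels.Site 3)}; let pc : ℝ → ℝ := fun t => sInf ({p : ℝ | 0 ≤ p ∧ p ≤ 1 ∧ 0 < θ p t} ∪ {1}); ∀ lo hi : ℝ, 0 < lo → lo < hi → hi < 1 → ∃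 ρ > (0 : ℝ), ∃ L : ℝ, ∀ ε > (0 : ℝ), ∃ R₀ : ℕ, ∀ R ≥ R₀, ∀ t ∈ Set.Icc lo hi, ∀ p q : ℝ, pc t ≤ p → p ≤ pc t + ρ → pc t ≤ q → q ≤ pc t + ρ → |deriv (fun s => Θ R p s) t / deriv (fun w => Θ R w t) p - deriv (fun s => Θ R q s) t / deriv (fun w => Θ R w t) q| ≤ L * |p - q| + ε

end Stubs

/-! ## `Iff.rfl` readings -/

/-- The crux over the named objects. -/
theorem crux_iff : SupercritExchangeUniformity ↔
    ∀ lo hi : ℝ, 0 < lo → lo < hi → hi < 1 → ∃ ρ > (0 : ℝ), ∃ L : ℝ, ∃ a : ℝ → ℝ → ℝ,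
      ContinuousOn (fun x : ℝ × ℝ => a x.1 x.2) (collar lo hi ρ) ∧
        (∀ t ∈ Set.Icc lo hi, ∀ p q : ℝ, pcA t ≤ p → p ≤ pcA t + ρ → pcA t ≤ q → q ≤ pcA t + ρ →
          |a p t - a q t| ≤ L * |p - q|) ∧
        ∀ η > (0 : ℝ), ∃ m : ℕ, ∀ n ≥ m, ∀ t ∈ Set.Icc lo hi, ∀ p : ℝ, pcA t ≤ p → p ≤ pcA t + ρ →
          |dT n p t - a p t * dP n p t| ≤ η * dP n p t :=
  Iff.rfl

/-- Stub 1 (verbatim) over the named objects. -/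
theorem derivativeFacts_iff : Stubs.stub_derivativeFacts ↔
    ∀ lo hi : ℝ, 0 < lo → lo < hi → hi < 1 → ∃ ρ > (0 : ℝ),
      (∀ R n : ℕ, ∀ t ∈ Set.Icc lo hi, ∀ p : ℝ, pcA t ≤ p → p ≤ pcA t + ρ →
        HasDerivAt (fun q => boxArm n q t) (∑ x ∈ centres n R, SH n R x p t) p ∧
        HasDerivAt (fun s => boxArm n p s) (∑ x ∈ centres n R, SV n R x p t) t) ∧
      (∀ n : ℕ, 1 ≤ n → ∀ t ∈ Set.Icc lo hi, ∀ p : ℝ, pcA t ≤ p → p ≤ pcA t + ρ → 0 < dP n p t) ∧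
      (∀ n : ℕ, 1 ≤ n → ContinuousOn (fun x : ℝ × ℝ => rate n x.1 x.2) (collar lo hi ρ)) :=
  Iff.rfl

/-- Stub 1a (verbatim) over the named objects. -/
theorem russoBlock_iff : Stubs.stub_russoBlock ↔
    ∀ R n : ℕ, ∀ p ∈ Set.Ioo (0 : ℝ) 1, ∀ t ∈ Set.Ioo (0 : ℝ) 1,
      HasDerivAt (fun q => boxArm n q t) (∑ x ∈ centres n R, SH n R x p t) p ∧
        HasDerivAt (fun s => boxArm n p s) (∑ x ∈ centres n R, SV n R x p t) t :=
  Iff.rfl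

/-- Stub 1b (verbatim) over the named objects. -/
theorem partialsContinuous_iff : Stubs.stub_partialsContinuous ↔
    ∀ n : ℕ, ContinuousOn (fun x : ℝ × ℝ => dT n x.1 x.2) (Set.Ioo (0 : ℝ) 1 ×ˢ Set.Ioo (0 : ℝ) 1) ∧
      ContinuousOn (fun x : ℝ × ℝ => dP n x.1 x.2) (Set.Ioo (0 : ℝ) 1 ×ˢ Set.Ioo (0 : ℝ) 1) :=
  Iff.rfl

/-- Stub 2 (verbatim) over the named objects. -/
theorem localHomogeneity_iff : Stubs.stub_localHomogeneity ↔
    ∀ lo hi : ℝ, 0 < lo → lo < hi → hi < 1 → ∃ ρ > (0 : ℝ), ∀ η > (0 : ℝ), ∃ R : ℕ, ∃ m : ℕ, ∀ n ≥ m,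
      ∀ t ∈ Set.Icc lo hi, ∀ p : ℝ, pcA t ≤ p → p ≤ pcA t + ρ →
        ∑ x ∈ centres n R, |SV n R x p t - rate R p t * SH n R x p t| ≤ η * ∑ x ∈ centres n R, SH n R x p t :=
  Iff.rfl

/-- Stub 3 (verbatim) over the named objects. -/
theorem boxRateAsymptoticLipschitz_iff : Stubs.stub_boxRateAsymptoticLipschitz ↔
    ∀ lo hi : ℝ, 0 < lo → lo < hi → hi < 1 → ∃ ρ > (0 : ℝ), ∃ L : ℝ, ∀ ε > (0 : ℝ), ∃ R₀ : ℕ, ∀ R ≥ R₀,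
      ∀ t ∈ Set.Icc lo hi, ∀ p q : ℝ, pcA t ≤ p → p ≤ pcA t + ρ → pcA t ≤ q → q ≤ pcA t + ρ →
        |rate R p t - rate R q t| ≤ L * |p - q| + ε :=
  Iff.rfl

/-! ## The four registered stubs -/

/-- **stub 1a (registered): `russoBlock`** — two-parameter Russo in block-summed form on the open unit square.  Why true: the
tree's Russo along `p` and along `t` (`SubcritExchangeUniformity.hasDerivAt_thetaBox_p/t`: derivative = `Σ_{e ∈ Λ_n.sym2}`
1[horizontal/vertical lattice bond] · P(e pivotal)`), the identification of `I n p t e` with the `prodBernoulli` pivotality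
probability (`real_cfg` + `isPivotal_iff_of_isUpperSet`), pivotality vanishing off `Λ_n.sym2` (`determinedBy_siteToBoundary`), and
Finset re-indexing: the `R`-blocks of `centres n R = (2R+1)ℤ³ ∩ Λ_{n+2R}` are disjoint and cover `Λ_n`.  Size M. -/
theorem stub_russoBlock :
    let μ := Literature.Probability.Percolation.labelMeasure (Literature.Probability.LatticeModels.Site 3); let vert : Sym2 (Literature.Probability.LatticeModels.Site 3) → Prop := fun e => ∃ x : Literature.Probability.LatticeModels.Site 3, e = s(x, x + Pi.single (2 : Fin 3) 1); let cfg : ℝ → ℝ → (Sym2 (Literature.Probability.LatticeModels.Site 3) → ℝ) → Set (Sym2 (Literature.Probability.LatticeModels.Site 3)) := fun p t U => {e | e ∈ (Literature.Probability.LatticeModels.zdGraph 3).edgeSet ∧ ((vert e ∧ U e ≤ t) ∨ (¬ vert e ∧ U e ≤ p))}; let Θ : ℕ → ℝ → ℝ → ℝ := fun n p t => μ.real {U | cfg p t U ∈ Literature.Probability.Percolation.siteToBoundary 3 n}; let I : ℕ → ℝ → ℝ → Sym2 (Literature.Probability.LatticeModels.Site 3) → ℝ := fun n p t e => μ.real {U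 | insert e (cfg p t U) ∈ Literature.Probability.Percolation.siteToBoundary 3 n ∧ (cfg p t U) \ {e} ∉ Literature.Probability.Percolation.siteToBoundary 3 n}; let SV : ℕ → ℕ → Literature.Probability.LatticeModels.Site 3 → ℝ → ℝ → ℝ := fun n R x p t => ∑ y ∈ Literature.Probability.LatticeModels.box 3 R, I n p t s(x + y, x + y + Pi.single (2 : Fin 3) 1); let SH : ℕ → ℕ → Literature.Probability.LatticeModels.Site 3 → ℝ → ℝ → ℝ := fun n R x p t => ∑ y ∈ Literature.Probability.LatticeModels.box 3 R, (I n p t s(x + y, x + y + Pi.single (0 : Fin 3) 1) + I n p t s(x + y, x + y + Pi.single (1 : Fin 3) 1)); let centres : ℕ → ℕ → Finset (Literature.Probability.LatticeModels.Site 3) := fun n R => (Literature.Probability.LatticeModels.box 3 (n + 2 * R)).filter (fun x => ∀ i : Fin 3, ((2 * R + 1 : ℕ) : ℤ) ∣ x i); ∀ R n : ℕ, ∀ p ∈ Set.Ioo (0 : ℝ) 1, ∀ t ∈ Set.Ioo (0 : ℝ) 1, HasDerivAt (fun q => Θ n q t) (∑ x ∈ centres n R, SH n R x p t) p ∧ HasDerivAt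 (fun s => Θ n p s) (∑ x ∈ centres n R, SV n R x p t) t := by
  sorry

/-- **stub 1b (registered): `partialsContinuous`** — joint continuity of `∂_tΘ_n` and `∂_pΘ_n` on the open unit square.  Why
true: `Θ_n` is `C¹` there (`ModelFacts.modelFacts_proof`, clause 2), and the partials are the Fréchet derivative applied to the
basis vectors; alternatively Russo's explicit sums of pivotality probabilities, each jointly continuous
(`continuous_prodBernoulli_real_of_determinedBy`).  Size S/M. -/
theorem stub_partialsContinuous :
    let μ := Literature.Probability.Percolation.labelMeasure (Literature.Probability.LatticeModels.Site 3); let vert : Sym2 (Literature.Probability.LatticeModels.Site 3) → Prop := fun e => ∃ x : Literature.Probability.LatticeModels.Site 3, e = s(x, x + Pi.single (2 : Fin 3) 1); let cfg : ℝ → ℝ → (Sym2 (Literature.Probability.LatticeModels.Site 3) → ℝ) → Set (Sym2 (Literature.Probability.LatticeModels.Site 3)) := fun p t U => {e | e ∈ (Literature.Probability.LatticeModels.zdGraph 3).edgeSet ∧ ((vert e ∧ U e ≤ t) ∨ (¬ vert e ∧ U e ≤ p))}; let Θ : ℕ → ℝ → ℝ → ℝ := fun n p t => μ.real {U | cfg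 p t U ∈ Literature.Probability.Percolation.siteToBoundary 3 n}; ∀ n : ℕ, ContinuousOn (fun x : ℝ × ℝ => deriv (fun s => Θ n x.1 s) x.2) (Set.Ioo (0 : ℝ) 1 ×ˢ Set.Ioo (0 : ℝ) 1) ∧ ContinuousOn (fun x : ℝ × ℝ => deriv (fun q => Θ n q x.2) x.1) (Set.Ioo (0 : ℝ) 1 ×ˢ Set.Ioo (0 : ℝ) 1) := by
  sorry

/-- **stub 2 (registered, LOAD-BEARING): `localHomogeneity`** — ℓ¹-block mark mixing.  Why plausibly true: the law
of the lattice-scale neighbourhood of a bottleneck edge given the macroscopic two-arm structure forgets position,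
shape, `n` and the window parameter (2D: GarbanPeteSchramm2013Pivotal Prop. 11/15, RSW-only); regions whose local
structure is non-critical carry negligible pivotal mass; MC j024461: V/H by shell flat to ±2 % on ≥ 90 % of the mass,
face bias confined to depth ≤ 3–4, face-layer mass ~ n^{-2.3}.  Why it might fail: no RSW / interface separation /
IIC in d = 3; it is stronger than K⁺.  Size: open problem. -/
theorem stub_localHomogeneity :
    let μ := Literature.Probability.Percolation.labelMeasure (Literature.Probability.LatticeModels.Site 3); let vert : Sym2 (Literature.Probability.LatticeModels.Site 3) → Prop := fun e => ∃ x : Literature.Probability.LatticeModels.Site 3, e = s(x, x + Pi.single (2 : Fin 3) 1); let cfg : ℝ → ℝ → (Sym2 (Literature.Probability.LatticeModels.Site 3) → ℝ) → Set (Sym2 (Literature.Probability.LatticeModels.Site 3)) := fun p t U => {e | e ∈ (Literature.Probability.LatticeModels.zdGraph 3).edgeSet ∧ ((vert e ∧ U e ≤ t) ∨ (¬ vert e ∧ U e ≤ p))}; let Θ : ℕ → ℝ → ℝ → ℝ := fun n p t => μ.real {U | cfg p t U ∈ Literature.Probability.Percolation.siteToBoundary 3 n}; let θ : ℝ → ℝ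 → ℝ := fun p t => μ.real {U | cfg p t U ∈ Literature.Probability.Percolation.percolatesAt (0 : Literature.Probability.LatticeModels.Site 3)}; let pc : ℝ → ℝ := fun t => sInf ({p : ℝ | 0 ≤ p ∧ p ≤ 1 ∧ 0 < θ p t} ∪ {1}); let I : ℕ → ℝ → ℝ → Sym2 (Literature.Probability.LatticeModels.Site 3) → ℝ := fun n p t e => μ.real {U | insert e (cfg p t U) ∈ Literature.Probability.Percolation.siteToBoundary 3 n ∧ (cfg p t U) \ {e} ∉ Literature.Probability.Percolation.siteToBoundary 3 n}; let SV : ℕ → ℕ → Literature.Probability.LatticeModels.Site 3 → ℝ → ℝ → ℝ := fun n R x p t => ∑ y ∈ Literature.Probability.LatticeModels.box 3 R, I n p t s(x + y, x + y + Pi.single (2 : Fin 3) 1); let SH : ℕ → ℕ → Literature.Probability.LatticeModels.Site 3 → ℝ → ℝ → ℝ := fun n R x p t => ∑ y ∈ Literature.Probability.LatticeModels.box 3 R, (I n p t s(x + y, x + y + Pi.single (0 : Fin 3) 1) + I n p t s(x + y, x + y + Pi.single (1 : Fin 3) 1)); let centres : ℕ → ℕ → Finset (Literature.Probability.LatticeModels.Site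 3) := fun n R => (Literature.Probability.LatticeModels.box 3 (n + 2 * R)).filter (fun x => ∀ i : Fin 3, ((2 * R + 1 : ℕ) : ℤ) ∣ x i); ∀ lo hi : ℝ, 0 < lo → lo < hi → hi < 1 → ∃ ρ > (0 : ℝ), ∀ η > (0 : ℝ), ∃ R : ℕ, ∃ m : ℕ, ∀ n ≥ m, ∀ t ∈ Set.Icc lo hi, ∀ p : ℝ, pc t ≤ p → p ≤ pc t + ρ → ∑ x ∈ centres n R, |SV n R x p t - (deriv (fun s => Θ R p s) t / deriv (fun q => Θ R q t) p) * SH n R x p t| ≤ η * ∑ x ∈ centres n R, SH n R x p t := by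
  sorry

/-- **stub 3 (registered): `boxRateAsymptoticLipschitz`** — asymptotic `p`-Lipschitz regularity of the box rates,
uniformly on the closed collar.  Why plausibly true: RG, `a = u_t/u_p + O(u) + O(u^{1+νω})` (the `u^{νω}` amplitude
corrections cancel in the ratio) and `a_R − a = O(R^{-1/ν})` uniformly; why it might fail: a Hölder boundary modulus
of the level-slope field of `θ` at the curve.  Size: open problem (regularity half of K⁺). [doi:10.1103/PhysRevB.27.4394; arXiv:1302.0421; ChayesSchonmann2000] -/
theorem stub_boxRateAsymptoticLipschitz :
    let μ := Literature.Probability.Percolation.labelMeasure (Literature.Probability.LatticeModels.Site 3); let vert : Sym2 (Literature.Probability.LatticeModels.Site 3) → Prop := fun e => ∃ x : Literature.Probability.LatticeModels.Site 3, e = s(x, x + Pi.single (2 : Fin 3) 1); let cfg : ℝ → ℝ → (Sym2 (Literature.Probability.LatticeModels.Site 3) → ℝ) → Set (Sym2 (Literature.Probability.LatticeModels.Site 3)) := fun p t U => {e | e ∈ (Literature.Probability.LatticeModels.zdGraph 3).edgeSet ∧ ((vert e ∧ U e ≤ t) ∨ (¬ vert e ∧ U e ≤ p))}; let Θ : ℕ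 → ℝ → ℝ → ℝ := fun n p t => μ.real {U | cfg p t U ∈ Literature.Probability.Percolation.siteToBoundary 3 n}; let θ : ℝ → ℝ → ℝ := fun p t => μ.real {U | cfg p t U ∈ Literature.Probability.Percolation.percolatesAt (0 : Literature.Probability.LatticeModels.Site 3)}; let pc : ℝ → ℝ := fun t => sInf ({p : ℝ | 0 ≤ p ∧ p ≤ 1 ∧ 0 < θ p t} ∪ {1}); ∀ lo hi : ℝ, 0 < lo → lo < hi → hi < 1 → ∃ ρ > (0 : ℝ), ∃ L : ℝ, ∀ ε > (0 : ℝ), ∃ R₀ : ℕ, ∀ R ≥ R₀, ∀ t ∈ Set.Icc lo hi, ∀ p q : ℝ, pc t ≤ p → p ≤ pc t + ρ → pc t ≤ q → q ≤ pc t + ρ → |deriv (fun s => Θ R p s) t / deriv (fun w => Θ R w t) p - deriv (fun s => Θ R q s) t / deriv (fun w => Θ R w t) q| ≤ L * |p - q| + ε := by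
  sorry

/-! ## Derived: the old stub 1 from stubs 1a, 1b and the landed sibling theorems -/

/-- **`derivativeFacts` (formerly stub 1) from `stub_russoBlock`, `stub_partialsContinuous` and the landed K⁻ theorems**:
collar placement `ρ := (1 - q₀)/2` with `p_c(t) ≤ q₀ < 1` (`exists_density_thetaPerc_pos`) and `0 < p_c(t)` (`pc_mem_Ioo`) puts
the closed collar inside the open square, where Russo (1a), positivity (`thetaBox_deriv_p_pos`) and continuity (1b, ratio with a
positive denominator) hold. -/
theorem derivativeFacts_of_stubs (hR : Stubs.stub_russoBlock) (hC : Stubs.stub_partialsContinuous) :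
    Stubs.stub_derivativeFacts := by
  refine derivativeFacts_iff.2 fun lo hi hlo hlh hhi => ?_
  obtain ⟨q₀, hq₀, hq₁, hθq⟩ := Theorems.SubcritExchangeUniformity.exists_density_thetaPerc_pos
  have hpc_le : ∀ t, pcA t ≤ q₀ := fun t => by
    refine csInf_le ⟨0, ?_⟩ (Or.inl ⟨hq₀, hq₁.le, hθq t⟩)
    rintro p (⟨hp, -⟩ | hp)
    · exact hp
    · rw [Set.mem_singleton_iff] at hp; rw [hp]; exact zero_le_one
  have hρ : 0 < (1 - q₀) / 2 := by linarith
  have hsq : ∀ t ∈ Set.Icc lo hi, ∀ p : ℝ, pcA t ≤ p → p ≤ pcA t + (1 - q₀) / 2 →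
      p ∈ Set.Ioo (0 : ℝ) 1 ∧ t ∈ Set.Ioo (0 : ℝ) 1 := by
    intro t ht p hp1 hp2
    have ht' : t ∈ Set.Ioo (0 : ℝ) 1 := ⟨hlo.trans_le ht.1, ht.2.trans_lt hhi⟩
    have hpc := Theorems.SubcritExchangeUniformity.pc_mem_Ioo t ht'
    have h0 : 0 < pcA t := hpc.1
    have h1 := hpc_le t
    exact ⟨⟨h0.trans_le hp1, by linarith⟩, ht'⟩
  have hpos8 := Theorems.SubcritExchangeUniformity.thetaBox_deriv_p_pos
  refine ⟨(1 - q₀) / 2, hρ, ?_, ?_, ?_⟩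
  · intro R n t ht p hp1 hp2
    obtain ⟨hp, ht'⟩ := hsq t ht p hp1 hp2
    exact (russoBlock_iff.1 hR) R n p hp t ht'
  · intro n hn t ht p hp1 hp2
    obtain ⟨hp, ht'⟩ := hsq t ht p hp1 hp2
    exact hpos8 n hn p hp t ht'
  · intro n hn
    obtain ⟨hT, hP⟩ := (partialsContinuous_iff.1 hC) n
    have hsub : collar lo hi ((1 - q₀) / 2) ⊆ Set.Ioo (0 : ℝ) 1 ×ˢ Set.Ioo (0 : ℝ) 1 := by
      rintro x ⟨hx1, hx2, hx3⟩
      obtain ⟨hp, ht'⟩ := hsq x.2 hx1 x.1 hx2 hx3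
      exact Set.mk_mem_prod hp ht'
    refine (hT.mono hsub).div (hP.mono hsub) ?_
    rintro x ⟨hx1, hx2, hx3⟩
    obtain ⟨hp, ht'⟩ := hsq x.2 hx1 x.1 hx2 hx3
    exact (hpos8 n hn x.1 hp x.2 ht').ne'

/-! ## Proved composition -/

/-- **`SupercritExchangeUniformity` from the four stubs** (hypotheses = the stub `Prop`s `Stubs.stub_*` BY NAME;
conclusion = the route decl by name; no `sorry`). -/
theorem SupercritExchangeUniformity_of (hR : Stubs.stub_russoBlock) (hC : Stubs.stub_partialsContinuous)
    (hH : Stubs.stub_localHomogeneity) (hL : Stubs.stub_boxRateAsymptoticLipschitz) :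
    Summit.CriticalPhenomena.PercolationContinuityZ3.Theses.PercExchangeRateTransport.SupercritExchangeUniformity := by
  have hF : Stubs.stub_derivativeFacts := derivativeFacts_of_stubs hR hC
  refine crux_iff.2 fun lo hi hlo hlh hhi => ?_
  obtain ⟨ρ₁, hρ₁, hRusso, hpos, hcont⟩ := derivativeFacts_iff.1 hF lo hi hlo hlh hhi
  obtain ⟨ρ₂, hρ₂, hhom⟩ := localHomogeneity_iff.1 hH lo hi hlo hlh hhi
  obtain ⟨ρ₃, hρ₃, L, hlip⟩ := boxRateAsymptoticLipschitz_iff.1 hL lo hi hlo hlh hhi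
  set ρ : ℝ := min ρ₁ (min ρ₂ ρ₃) with hρdef
  have hρ : 0 < ρ := lt_min hρ₁ (lt_min hρ₂ hρ₃)
  have hρ1 : ρ ≤ ρ₁ := min_le_left _ _
  have hρ2 : ρ ≤ ρ₂ := (min_le_right _ _).trans (min_le_left _ _)
  have hρ3 : ρ ≤ ρ₃ := (min_le_right _ _).trans (min_le_right _ _)
  -- Step A: Russo + homogeneity + triangle inequality over blocks: |dT n − rate R · dP n| ≤ η dP n
  have stepA : ∀ η > (0 : ℝ), ∃ R m : ℕ, ∀ n ≥ m, ∀ t ∈ Set.Icc lo hi, ∀ p : ℝ, pcA t ≤ p → p ≤ pcA t + ρ →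
      |dT n p t - rate R p t * dP n p t| ≤ η * dP n p t := by
    intro η hη
    obtain ⟨R, m, hm⟩ := hhom η hη
    refine ⟨R, m, fun n hn t ht p hp1 hp2 => ?_⟩
    have h := hm n hn t ht p hp1 (hp2.trans (by linarith))
    obtain ⟨hdp, hdt⟩ := hRusso R n t ht p hp1 (hp2.trans (by linarith))
    have eT : dT n p t = ∑ x ∈ centres n R, SV n R x p t := by unfold dT; exact hdt.deriv
    have eP : dP n p t = ∑ x ∈ centres n R, SH n R x p t := by unfold dP; exact hdp.deriv
    rw [eT, eP, Finset.mul_sum, ← Finset.sum_sub_distrib]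
    exact (Finset.abs_sum_le_sum_abs _ _).trans h
  -- Step B: ratio form, |rate n − rate R| ≤ η, for n ≥ max m 1 (positivity)
  have stepB : ∀ η > (0 : ℝ), ∃ R m : ℕ, ∀ n ≥ m, ∀ t ∈ Set.Icc lo hi, ∀ p : ℝ, pcA t ≤ p → p ≤ pcA t + ρ →
      |rate n p t - rate R p t| ≤ η := by
    intro η hη
    obtain ⟨R, m, hm⟩ := stepA η hη
    refine ⟨R, max m 1, fun n hn t ht p hp1 hp2 => ?_⟩
    have hn₁ : m ≤ n := le_trans (le_max_left _ _) hn
    have hn₀ : 1 ≤ n := le_trans (le_max_right _ _) hn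
    have hD : 0 < dP n p t := hpos n hn₀ t ht p hp1 (hp2.trans (by linarith))
    have h := hm n hn₁ t ht p hp1 hp2
    have e : rate n p t - rate R p t = (dT n p t - rate R p t * dP n p t) / dP n p t := by
      unfold rate; field_simp
    rw [e, abs_div, abs_of_pos hD, div_le_iff₀ hD]
    exact h
  -- Step C: pointwise, the rates form a Cauchy sequence on the collar, hence converge to their `limUnder`
  set aLim : ℝ → ℝ → ℝ := fun p t => limUnder atTop (fun n : ℕ => rate n p t) with haLim
  have hconv : ∀ t ∈ Set.Icc lo hi, ∀ p : ℝ, pcA t ≤ p → p ≤ pcA t + ρ →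
      Tendsto (fun n : ℕ => rate n p t) atTop (𝓝 (aLim p t)) := by
    intro t ht p hp1 hp2
    have hC : CauchySeq (fun n : ℕ => rate n p t) := by
      rw [Metric.cauchySeq_iff']
      intro ε hε
      obtain ⟨R, m, hm⟩ := stepB (ε / 3) (by positivity)
      refine ⟨m, fun n hn => ?_⟩
      rw [Real.dist_eq]
      have h1 := hm n hn t ht p hp1 hp2
      have h2 := hm m le_rfl t ht p hp1 hp2
      calc |rate n p t - rate m p t| ≤ |rate n p t - rate R p t| + |rate R p t - rate m p t| := abs_sub_le _ _ _
        _ ≤ ε / 3 + ε / 3 := by rw [abs_sub_comm (rate R p t)]; exact add_le_add h1 h2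
        _ < ε := by linarith
    exact hC.tendsto_limUnder
  -- Step D: the convergence is uniform on the collar
  have stepD : ∀ η > (0 : ℝ), ∃ m : ℕ, ∀ n ≥ m, ∀ t ∈ Set.Icc lo hi, ∀ p : ℝ, pcA t ≤ p → p ≤ pcA t + ρ →
      |rate n p t - aLim p t| ≤ η := by
    intro η hη
    obtain ⟨R, m, hm⟩ := stepB (η / 2) (by positivity)
    refine ⟨m, fun n hn t ht p hp1 hp2 => ?_⟩
    have hlim := hconv t ht p hp1 hp2
    have hcts : Tendsto (fun n' : ℕ => |rate n p t - rate n' p t|) atTop (𝓝 |rate n p t - aLim p t|) :=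
      (tendsto_const_nhds.sub hlim).abs
    refine le_of_tendsto hcts ?_
    filter_upwards [eventually_ge_atTop m] with n' hn'
    have h1 := hm n hn t ht p hp1 hp2
    have h2 := hm n' hn' t ht p hp1 hp2
    calc |rate n p t - rate n' p t| ≤ |rate n p t - rate R p t| + |rate R p t - rate n' p t| := abs_sub_le _ _ _
      _ ≤ η / 2 + η / 2 := by rw [abs_sub_comm (rate R p t)]; exact add_le_add h1 h2
      _ = η := by ring
  -- Assembly of K⁺'s three clauses with `ρ`, `L`, `aLim`
  refine ⟨ρ, hρ, L, aLim, ?_, ?_, ?_⟩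
  · -- continuity on the closed collar: uniform limit of (eventually) continuous functions
    have hU : TendstoUniformlyOn (fun (n : ℕ) (x : ℝ × ℝ) => rate n x.1 x.2) (fun x : ℝ × ℝ => aLim x.1 x.2) atTop
        (collar lo hi ρ) := by
      rw [Metric.tendstoUniformlyOn_iff]
      intro ε hε
      obtain ⟨m, hm⟩ := stepD (ε / 2) (by positivity)
      filter_upwards [eventually_ge_atTop m] with n hn x hx
      obtain ⟨hx1, hx2, hx3⟩ := hx
      have h := hm n hn x.2 hx1 x.1 hx2 hx3
      rw [Real.dist_eq, abs_sub_comm]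
      linarith
    refine hU.continuousOn (Filter.Eventually.frequently ?_)
    filter_upwards [eventually_ge_atTop 1] with n hn
    exact (hcont n hn).mono fun x ⟨hx1, hx2, hx3⟩ => ⟨hx1, hx2, hx3.trans (by linarith)⟩
  · -- Lipschitz in p: limit of the asymptotic Lipschitz bounds of the box rates
    intro t ht p q hp1 hp2 hq1 hq2
    refine le_of_forall_pos_le_add fun ε hε => ?_
    obtain ⟨R₀, hR₀⟩ := hlip ε hε
    have h1 := hconv t ht p hp1 hp2
    have h2 := hconv t ht q hq1 hq2
    have hcts : Tendsto (fun R : ℕ => |rate R p t - rate R q t|) atTop (𝓝 |aLim p t - aLim q t|) := (h1.sub h2).abs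
    refine le_of_tendsto hcts ?_
    filter_upwards [eventually_ge_atTop R₀] with R hR
    exact hR₀ R hR t ht p q hp1 (hp2.trans (by linarith)) hq1 (hq2.trans (by linarith))
  · -- the η-clause: multiply the uniform ratio bound back by ∂_pΘ_n > 0
    intro η hη
    obtain ⟨m, hm⟩ := stepD η hη
    refine ⟨max m 1, fun n hn t ht p hp1 hp2 => ?_⟩
    have hn₁ : m ≤ n := le_trans (le_max_left _ _) hn
    have hn₀ : 1 ≤ n := le_trans (le_max_right _ _) hn
    have hD : 0 < dP n p t := hpos n hn₀ t ht p hp1 (hp2.trans (by linarith))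
    have h := hm n hn₁ t ht p hp1 hp2
    have e : dT n p t - aLim p t * dP n p t = (rate n p t - aLim p t) * dP n p t := by
      unfold rate; field_simp
    rw [e, abs_mul, abs_of_pos hD]
    exact mul_le_mul_of_nonneg_right h hD.le

/-- Wiring check: the registered stubs feed the composition as stated. -/
example : Summit.CriticalPhenomena.PercolationContinuityZ3.Theses.PercExchangeRateTransport.SupercritExchangeUniformity :=
  SupercritExchangeUniformity_of stub_russoBlock stub_partialsContinuous stub_localHomogeneity
    stub_boxRateAsymptoticLipschitz

end Summit.CriticalPhenomena.PercolationContinuityZ3.Cruxes.SupercritExchangeUniformity.LocalExchangeHomogeneity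

end
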